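import Summits.RiemannHypothesis.RiemannHypothesis.Theorems.ThetaTier1Arith
import HarnessLib

/-!
# THETA tier-1 kernel checker — the CHEBYSHEV variant of the prime-tail constant (RS-free; cc-s2-1, WEIL typing lane;
RH-FREE bookkeeping)

`ThetaTier1Arith` evaluates THETA-CERT-cc6 D6's cross term with the Rosser–Schoenfeld constant `RS = 1.03883` (a named fact
`ψ(x) < 1.03883x` on the analytic side).  handoff-prove-2's `WeilColumnThetaPrimeTailCheb` (ATTEMPT-22 §5) shows that the partial
summation only uses `ψ` on `[N, ∞)`, `N = q e^{2δ−2η′} ≥ e²`, where Mathlib's `Chebyshev.psi_le` gives `ψ(x) ≤ C(N)·x` with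
`C(N) = log 4 + 2 log N/√N` — NO hypothesis.  Director ruling 2026-08-26T05:40Z (decision cc-s2-1, STATUS 06:0xZ): the data are
certified with `C(N)` in place of `RS`.  In the register program this is ONE instruction: register 31 becomes
`cross = 2·C(N)·M²·(1/m² + e^{−m/(m+1)}/(m+1))` with `C(N) = 2 log 2 + 2 (log q + 2δ − 2η′)·u₁` (exactly: `log N = log q + 2δ − 2η′`,
`N^{-1/2} = u₁`; registers 9, 19, 21 — no new atom), plus the side condition `2 ≤ log N`.  This file: the variant program
`Row.insCheb`, its real registers `Row.envCheb`, the verdict `checkAllCheb` and its soundness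
`checkAllCheb_sound : checkAllCheb rows = true → ∀ r ∈ rows, r.RealCertCheb`.  Nothing here bears on the truth of RH.
-/

set_option linter.dupNamespace false  -- the mandated namespace repeats `RiemannHypothesis`
set_option autoImplicit false

namespace Summit.RiemannHypothesis.RiemannHypothesis.Theorems.ThetaTier1

open Literature.Analysis.ValidatedNumerics
open Literature.Analysis.ValidatedNumerics.NumericsMP

/-! ## The variant program -/

/-- `C(N) = log 4 + 2 log N/√N = 2 log 2 + 2 (log q + 2δ − 2η′)·u₁` (`log N = log q + 2δ − 2η′`, `N^{-1/2} = u₁`).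
[this cell, handoff-prove-2 ATTEMPT-22 §5] -/
def Row.iCcheb (r : Row) : RExpr :=
  .add (.mul (.const 2) (.var 9)) (.mul (.mul (.const 2) (.add (.var 19) (.const (2 * r.delta - 2 * ETA)))) (.var 21))

/-- 31′: `cross = 2·C(N)·M²·(1/m² + e^{-m/(m+1)}/(m+1))` (D6's `V_T` part with the Chebyshev constant). [this cell, THETA-CERT-cc6 D6] -/
def Row.iCrossCheb (r : Row) : RExpr :=
  .mul (.mul (.const 2) r.iCcheb)
    (.mul (.sq (.var 25)) (.add (.const (1 / (r.m : ℚ) ^ 2)) (.mul (.var 16) (.const (1 / ((r.m : ℚ) + 1))))))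

/-- 41: `log N = log q + 2δ − 2η′` (for the side condition `e² ≤ N`). [this cell] -/
def Row.iLogN (r : Row) : RExpr := .add (.var 19) (.const (2 * r.delta - 2 * ETA))

/-- The Chebyshev-variant program: `Row.ins` with instruction 10 (register 31) replaced by `iCrossCheb`, plus register 41 = `log N`.
[this cell, THETA-CERT-cc6 D1–D9] -/
def Row.insCheb (r : Row) : List RExpr :=
  [r.iU1, r.iZeta, r.iMZ, r.iMZM, r.iM, r.iM1, r.iA, r.iBin, r.iB, r.iPrimesC, r.iCrossCheb, r.iJ, r.iArchc, r.iArch,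
   r.iML, r.iRbar, r.iAtom, r.iLoss, r.iGain, r.iWin, r.iLogN]

/-- The real registers of the variant program. [this cell] -/
noncomputable def Row.envCheb (r : Row) : ℕ → ℝ := runR r.insCheb r.vals 21

/-- `loss` with the Chebyshev cross term (register 38 of the variant). [this cell, THETA-CERT-cc6 D9] -/
noncomputable def Row.lossCheb (r : Row) : ℝ := r.envCheb 38

/-- `gain` (register 39 of the variant; the same value as `Row.gain`). [this cell, THETA-CERT-cc6 D9] -/
noncomputable def Row.gainCheb (r : Row) : ℝ := r.envCheb 39

/-- **What a Chebyshev-certified row asserts about real numbers**: the side conditions of THETA-CERT-cc6 §D SETTING, `2 ≤ log N`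
(`N = q e^{2δ−2η′} ≥ e²`, the range of Mathlib's Chebyshev bound in ATTEMPT-22 §5), and `lossCheb < gainCheb`.
[this cell, THETA-CERT-cc6 D9] -/
def Row.RealCertCheb (r : Row) : Prop :=
  r.q < r.qn ∧ 4 ≤ r.m ∧ r.m ≤ 7 ∧ 0 < r.delta ∧ 2 * r.delta < 7 / 80 ∧
    Real.exp (2 * (r.delta : ℝ)) * r.q < r.qn ∧ Real.exp (2 * (r.delta : ℝ)) < 2 ∧
    2 ≤ Real.log r.q + (2 * (r.delta : ℝ) - 1 / 10) ∧ r.lossCheb < r.gainCheb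

/-! ## The verdict and its soundness -/

/-- **The Chebyshev-variant row check**, given enclosures `cenv` of the constant atoms. [this cell, THETA-CERT-cc6 D9] -/
def Row.checkChebWith (cenv : List (NonemptyInterval ℚ)) (r : Row) : Bool :=
  decide (r.q < r.qn) && decide (4 ≤ r.m) && decide (r.m ≤ 7) && decide (0 < r.delta) &&
  decide (2 * r.delta < 7 / 80) &&
  match enclList r.rowAtoms with
  | none => false
  | some renv =>
    match runI PREC HERON r.insCheb (xOf (cenv ++ renv)) 21 with
    | none => false
    | some X => decide ((X 40).snd < r.qn) && decide ((X 12).snd < 2) && decide (2 ≤ (X 41).fst) &&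
        decide ((X 38).snd < (X 39).fst)

/-- **Check a list of rows with the Chebyshev constant**: the constant atoms are enclosed ONCE. [this cell] -/
def checkAllCheb (rows : List Row) : Bool :=
  match enclList constAtoms with
  | none => false
  | some cenv => rows.all (Row.checkChebWith cenv)

/-- Register `40` of the variant is `e^{2δ} q`. [this cell] -/
theorem Row.envCheb_forty (r : Row) : r.envCheb 40 = Real.exp (2 * (r.delta : ℝ)) * r.q := by
  simp [Row.envCheb, Row.insCheb, runR, Row.iWin, RExpr.eval, Row.vals_twelve]

/-- Register `12` of the variant stays `e^{2δ}`. [this cell] -/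
theorem Row.envCheb_twelve (r : Row) : r.envCheb 12 = Real.exp (2 * (r.delta : ℝ)) := by
  simp [Row.envCheb, Row.insCheb, runR, Row.vals_twelve]

/-- Atom `19` is `log q`. [this cell] -/
theorem Row.vals_nineteen (r : Row) : r.vals 19 = Real.log r.q := by
  simp [Row.vals, valOf, Row.atoms, constAtoms, Row.rowAtoms, Atom.val]

/-- Register `41` of the variant is `log N = log q + (2δ − 2η′)`. [this cell] -/
theorem Row.envCheb_fortyone (r : Row) : r.envCheb 41 = Real.log r.q + (2 * (r.delta : ℝ) - 1 / 10) := by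
  simp [Row.envCheb, Row.insCheb, runR, Row.iLogN, RExpr.eval, Row.vals_nineteen, ETA]
  norm_num

/-- **Soundness of the Chebyshev-variant row check.** [this cell; `RExpr.eval_mem_enclose` + the atoms' inclusion theorems] -/
theorem Row.checkChebWith_sound {cenv : List (NonemptyInterval ℚ)} (hc : enclList constAtoms = some cenv) {r : Row}
    (h : r.checkChebWith cenv = true) : r.RealCertCheb := by
  unfold Row.checkChebWith at h
  simp only [Bool.and_eq_true, decide_eq_true_eq] at h
  obtain ⟨⟨⟨⟨⟨hq, hm4⟩, hm7⟩, hd⟩, heps⟩, hrest⟩ := h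
  split at hrest
  · exact absurd hrest Bool.false_ne_true
  · rename_i renv hrenv
    have hx : ∀ i, r.vals i ∈ (xOf (cenv ++ renv) i).ratCast ℝ := mem_xOf_of_enclList (enclList_append hc hrenv)
    split at hrest
    · exact absurd hrest Bool.false_ne_true
    · rename_i X hX
      simp only [Bool.and_eq_true, decide_eq_true_eq] at hrest
      obtain ⟨⟨⟨hWq, hE2⟩, hN⟩, hLG⟩ := hrest
      have hreg : ∀ i, r.envCheb i ∈ (X i).ratCast ℝ := mem_runI (prec := PREC) (iters := HERON) r.insCheb hx hX
      have m40 := hreg 40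
      have m38 := hreg 38
      have m39 := hreg 39
      have m12 := hreg 12
      have m41 := hreg 41
      rw [NonemptyInterval.mem_ratCast_iff] at m40 m38 m39 m12 m41
      rw [Row.envCheb_forty] at m40
      rw [Row.envCheb_twelve] at m12
      rw [Row.envCheb_fortyone] at m41
      refine ⟨hq, hm4, hm7, hd, heps, ?_, ?_, ?_, ?_⟩
      · exact m40.2.trans_lt (by exact_mod_cast hWq)
      · exact m12.2.trans_lt (by exact_mod_cast hE2)
      · exact le_trans (by exact_mod_cast hN) m41.1
      · exact m38.2.trans_lt ((by exact_mod_cast hLG : ((_ : ℚ) : ℝ) < _).trans_le m39.1)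

/-- **Soundness of the Chebyshev-variant list check.** [this cell] -/
theorem checkAllCheb_sound {rows : List Row} (h : checkAllCheb rows = true) : ∀ r ∈ rows, r.RealCertCheb := by
  unfold checkAllCheb at h
  split at h
  · exact absurd h Bool.false_ne_true
  · rename_i cenv hc
    intro r hr
    exact Row.checkChebWith_sound hc (List.all_eq_true.1 h r hr)

end Summit.RiemannHypothesis.RiemannHypothesis.Theorems.ThetaTier1
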